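import Summits.QuantumFields.YangMills.Theorems.SwapVirialDeficitSwapGluedStiffnessOfTwoSectorStiffness
import Summits.QuantumFields.YangMills.Theorems.SwapVirialDeficitSectorLaplaceDefs
import HarnessLib

/-!
# (S)-road ➎: ⟨24197⟩ FROM TWO POLYNOMIAL STIFFNESS WINDOWS (the window bookkeeping of ✓`swapGluedStiffness_of_twoSectorStiffness`)
# (free-hands support of ⟨stmt-QuantumFields-24197⟩ `SwapVirialDeficit.SwapGluedStiffness`; cell ym-idea-1, LEAD g98 ruling 2026-08-31 18:47Z ∕ memo5, assembler fcl-p3 g47)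

The socket of record ✓`SwapRing.swapGluedStiffness_of_twoSectorStiffness` (w2 g57) wants `hTS : ∃ a c β₀ L₀, ∀ β ≥ β₀, ∀ L ≥ L₀, L ≤ β^a →
(9L⁴ − 3∕2 + c)·∫e^{−βF_z}dμ_L ≤ β·∫F_z e^{−βF_z}dμ_L` for BOTH even sectors `z = 000` (`z₀`), `001` (`z₁`).  Skeleton ➎ (LEAD g98: per-region stiffness, additive in
the measure) produces each sector's inequality on a POLYNOMIAL window `b ≥ K·L^q`.  This file is the arithmetic in between: with `a = 1∕(q+1)` and `L₀ > K` the
window condition `L ≤ β^a` forces `β ≥ L^{q+1} ≥ K·L^q`; `c = 1∕8`.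

* ★★ `twoSectorStiffness_of_windows` — two polynomial windows ⟹ `hTS` VERBATIM;  ★★★ `swapGluedStiffness_of_windows` — ⟹ `Theses.SwapVirialDeficit.SwapGluedStiffness`.

HONEST LABEL: arithmetic glue; both sector windows are HYPOTHESES (the regions' stiffness inequalities of ➎ are OPEN: (Ra) fcl-p3 g47 on w2's `bulk_fibred_plane`, (Rb)(Rd) w3 g66,
(Rc) w2 g59 + w3, sector 001 w3's charts); ⟨24197⟩ ∕ ⟨24194⟩ OPEN; ⟨24196⟩ proved elsewhere; item of record ⟨24085⟩ SubOctaveBounded aside ∕ untouched; the Yang–Mills mass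
gap is NOT proved; no summit is proved by a line.  THEOREMS ONLY (0 `def`, 0 `sorry`, no instance), standard axioms.  Seat ym-line-fcl-p3 g47 (cell ym-idea-1, free hands),
`--supports stmt-QuantumFields-24197`.  References: [cite: Griffiths1964]; [folklore].
-/

set_option autoImplicit false

noncomputable section

open MeasureTheory

namespace Summit.QuantumFields.YangMills.Theorems.SwapVirialDeficit.SectorLaplace

open Summit.QuantumFields.YangMills.Theorems.VirialFluxGap.RingDeficit
open Summit.QuantumFields.YangMills.Theorems.SwapVirialDeficit.SwapRing
open Literature.MathematicalPhysics.QuantumLattice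
open Literature.MathematicalPhysics.QuantumFieldTheory hiding SU2

/-! ## The two-sector window -/

/-- ★★★ **THE `hTS` OF ✓`swapGluedStiffness_of_twoSectorStiffness` FROM THE TWO POLYNOMIAL WINDOWS** (`c = 1∕8`; window exponent `a = 1∕(q+1)` with `q = max`,
`L₀ ≥ max K`, so that `L ≤ β^a` forces `β ≥ L^{q+1} ≥ K·L^q`). [folklore] -/
theorem twoSectorStiffness_of_windows
    (h0 : ∃ K : ℝ, 0 < K ∧ ∃ q : ℕ, ∀ (L : ℕ) [NeZero L] (b : ℝ), K * (L : ℝ) ^ q ≤ b →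
      (9 * (L : ℝ) ^ 4 - 3 / 2 + 1 / 8) * ∫ P, Real.exp (-(b * swapRingDeficit L z₀ P)) ∂(ringMeasure L) ≤
        b * ∫ P, swapRingDeficit L z₀ P * Real.exp (-(b * swapRingDeficit L z₀ P)) ∂(ringMeasure L))
    (h1 : ∃ K : ℝ, 0 < K ∧ ∃ q : ℕ, ∀ (L : ℕ) [NeZero L] (b : ℝ), K * (L : ℝ) ^ q ≤ b →
      (9 * (L : ℝ) ^ 4 - 3 / 2 + 1 / 8) * ∫ P, Real.exp (-(b * swapRingDeficit L z₁ P)) ∂(ringMeasure L) ≤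
        b * ∫ P, swapRingDeficit L z₁ P * Real.exp (-(b * swapRingDeficit L z₁ P)) ∂(ringMeasure L)) :
    ∃ a : ℝ, 0 < a ∧ ∃ c : ℝ, 0 < c ∧ ∃ β₀ : ℝ, ∃ L₀ : ℕ, ∀ β : ℝ, β₀ ≤ β → ∀ (L : ℕ) [NeZero L], L₀ ≤ L → (L : ℝ) ≤ β ^ a →
      (9 * (L : ℝ) ^ 4 - 3 / 2 + c) * ∫ P, Real.exp (-(β * swapRingDeficit L (fun _ => false) P)) ∂(ringMeasure L) ≤
          β * ∫ P, swapRingDeficit L (fun _ => false) P * Real.exp (-(β * swapRingDeficit L (fun _ => false) P)) ∂(ringMeasure L) ∧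
        (9 * (L : ℝ) ^ 4 - 3 / 2 + c) * ∫ P, Real.exp (-(β * swapRingDeficit L (fun k => decide (k = 2)) P)) ∂(ringMeasure L) ≤
          β * ∫ P, swapRingDeficit L (fun k => decide (k = 2)) P * Real.exp (-(β * swapRingDeficit L (fun k => decide (k = 2)) P)) ∂(ringMeasure L) := by
  obtain ⟨K₀, hK₀, q₀, h0⟩ := h0
  obtain ⟨K₁, hK₁, q₁, h1⟩ := h1
  set q : ℕ := max q₀ q₁ with hq
  set K : ℝ := max K₀ K₁ with hK
  have hKpos : 0 < K := lt_max_of_lt_left hK₀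
  refine ⟨1 / ((q : ℝ) + 1), by positivity, 1 / 8, by norm_num, 1, Nat.ceil K + 1, fun β hβ L _ hL hLβ => ?_⟩
  have hL1 : (1 : ℝ) ≤ L := by exact_mod_cast NeZero.one_le
  have hβ0 : 0 < β := by linarith
  -- `L ≥ K`
  have hLK : K ≤ (L : ℝ) := by
    have h1' : (Nat.ceil K : ℝ) + 1 ≤ (L : ℝ) := by exact_mod_cast hL
    linarith [Nat.le_ceil K]
  -- `β ≥ L^{q+1}`
  have hβL : (L : ℝ) ^ (q + 1) ≤ β := by
    have h2 : ((L : ℝ)) ^ (q + 1) ≤ (β ^ (1 / ((q : ℝ) + 1))) ^ (q + 1) := pow_le_pow_left₀ (by positivity) hLβ _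
    have h3 : (β ^ (1 / ((q : ℝ) + 1))) ^ (q + 1) = β := by
      rw [← Real.rpow_natCast, ← Real.rpow_mul hβ0.le]
      have : (1 / ((q : ℝ) + 1)) * ((q + 1 : ℕ) : ℝ) = 1 := by push_cast; field_simp
      rw [this, Real.rpow_one]
    rw [h3] at h2; exact h2
  have hwin : ∀ {K' : ℝ} {q' : ℕ}, K' ≤ K → q' ≤ q → K' * (L : ℝ) ^ q' ≤ β := by
    intro K' q' hK' hq'
    calc K' * (L : ℝ) ^ q' ≤ (L : ℝ) * (L : ℝ) ^ q :=
          mul_le_mul (hK'.trans hLK) (pow_le_pow_right₀ hL1 hq') (by positivity) (by positivity)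
      _ = (L : ℝ) ^ (q + 1) := by ring
      _ ≤ β := hβL
  have e8 : (9 * (L : ℝ) ^ 4 - 3 / 2 + 1 / 8) = 9 * (L : ℝ) ^ 4 - 3 / 2 + 1 / 8 := rfl
  have hA := h0 L β (hwin (le_max_left _ _) (le_max_left _ _))
  have hB := h1 L β (hwin (le_max_right _ _) (le_max_right _ _))
  rw [e8] at hA hB
  exact ⟨hA, hB⟩

/-- ★★★ **⟨24197⟩ FROM THE TWO POLYNOMIAL STIFFNESS WINDOWS** (✓`swapGluedStiffness_of_twoSectorStiffness` ∘ `twoSectorStiffness_of_windows`). [folklore] -/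
theorem swapGluedStiffness_of_windows
    (h0 : ∃ K : ℝ, 0 < K ∧ ∃ q : ℕ, ∀ (L : ℕ) [NeZero L] (b : ℝ), K * (L : ℝ) ^ q ≤ b →
      (9 * (L : ℝ) ^ 4 - 3 / 2 + 1 / 8) * ∫ P, Real.exp (-(b * swapRingDeficit L z₀ P)) ∂(ringMeasure L) ≤
        b * ∫ P, swapRingDeficit L z₀ P * Real.exp (-(b * swapRingDeficit L z₀ P)) ∂(ringMeasure L))
    (h1 : ∃ K : ℝ, 0 < K ∧ ∃ q : ℕ, ∀ (L : ℕ) [NeZero L] (b : ℝ), K * (L : ℝ) ^ q ≤ b →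
      (9 * (L : ℝ) ^ 4 - 3 / 2 + 1 / 8) * ∫ P, Real.exp (-(b * swapRingDeficit L z₁ P)) ∂(ringMeasure L) ≤
        b * ∫ P, swapRingDeficit L z₁ P * Real.exp (-(b * swapRingDeficit L z₁ P)) ∂(ringMeasure L)) :
    Summit.QuantumFields.YangMills.Theses.SwapVirialDeficit.SwapGluedStiffness :=
  swapGluedStiffness_of_twoSectorStiffness (twoSectorStiffness_of_windows h0 h1)

end Summit.QuantumFields.YangMills.Theorems.SwapVirialDeficit.SectorLaplace

end
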